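import Mathlib.NumberTheory.Padics.AddChar
import Mathlib.NumberTheory.Multiplicity
import Mathlib.RingTheory.ZMod.UnitsCyclic
import Mathlib.NumberTheory.Padics.RingHoms
import Mathlib.NumberTheory.Cyclotomic.CyclotomicCharacter
import Mathlib.RingTheory.RootsOfUnity.AlgebraicallyClosed
import Mathlib.RingTheory.Polynomial.Cyclotomic.Roots
import Mathlib.FieldTheory.Galois.Profinite
import Mathlib.FieldTheory.IsAlgClosed.AlgebraicClosure
import Literature.NumberTheory.GaloisRepresentations.GaloisRep
import Literature.NumberTheory.EllipticCurves.PAdicLFunction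
import Literature.NumberTheory.EllipticCurves.Iwasawa
import HarnessLib

/-!
# The cyclotomic `ℤ_p`-extension of `ℚ`, constructed (`κ_cyc = ℓ ∘ χ_p`)

This file *constructs* the cyclotomic `ℤ_p`-extension `κ_cyc : Γ_ℚ →ₜ* ℤ_p` of `ℚ`
(`Literature.ZpExtension ℚ p` with `IsCyclotomic`, i.e. `ker κ_cyc = χ_p⁻¹(μ(ℤ_p))`,
`ℚ̄^{ker} = ℚ_∞ ⊆ ℚ(μ_{p^∞})`) together with a normalised topological generator `γ`
(`κ_cyc γ = 1`, `χ_p(γ) = γ_cyc = 1 + p^{e₀}`), for every prime `p` including `p = 2`. It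
discharges the `K = ℚ` instances of the named facts `Literature.NumberTheory.EllipticCurves.ZpExtension.exists_isCyclotomic`
(`exists_isCyclotomic_rat`) and `Literature.NumberTheory.EllipticCurves.exists_cyclotomicZpExtension` (bsd.S22;
`exists_cyclotomicZpExtension_rat`), and feeds the discharge of
`Literature.NumberTheory.EllipticCurves.exists_isCyclotomic_isTopGenerator_isCyclotomicVariable` (in `KatoRankBoundProofs`).
Everything is proved from Mathlib; there are no new named facts.

## Construction

* `Literature.PadicOneUnits.oneAddPow p e : AddChar ℤ_[p] ℤ_[p]`, `x ↦ (1 + q)^x`, `q = p^{e+1}`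
  (Mathlib's `PadicInt.addChar_of_value_at_one`, the Mahler series `∑ (x choose k) q^k`). Under
  `e + 3 ≤ p (e + 1)` (automatic for odd `p`; `4 ∣ q` for `p = 2`) we prove
  `‖(1+q)^x - 1‖ = ‖x‖‖q‖` (`norm_oneAddPow_sub_one`: Serre's lemma "`x ∈ U_n - U_{n+1} ⇒
  x^p ∈ U_{n+1} - U_{n+2}`", *A Course in Arithmetic* II.3.2, from Mathlib's
  `ZMod.exists_one_add_mul_pow_prime_pow_eq` at `p`-powers, the quadratic congruence
  `(1+w)^a ≡ 1 + a w (mod w²)` = `sq_dvd_add_pow_sub_sub`, and density of `ℕ` in `ℤ_p`), hence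
  injectivity (`oneAddPow_injective`), and surjectivity onto `U_{e+1} = 1 + qℤ_p`
  (`exists_oneAddPow_eq`, by successive approximation and compactness) — Serre, loc. cit.,
  Prop. 8: `θ_α : ℤ_p ≅ U_1` (`p ≠ 2`), `ℤ_2 ≅ U_2`, `z ↦ α^z`.
* `Literature.NumberTheory.GaloisRepresentations.GaloisRep.cyclotomicCharacter_rat_surjective`: `χ_p : Γ_ℚ → ℤ_pˣ` is onto — level `p^n`
  by `Φ_{p^n}` irreducible over `ℚ` (Mathlib `Polynomial.cyclotomic_eq_minpoly_rat`) and
  `Normal.minpoly_eq_iff_mem_orbit` in `ℚ̄/ℚ`, then Cantor's intersection theorem in the compact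
  group `Γ_ℚ`.
* `Literature.CyclotomicZp.ell p : ℤ_[p]ˣ → ℤ_[p]`, the normalised logarithm `ℓ = log_p/log_p(γ_cyc)`,
  defined without `log_p` as the unique `x` with `γ_cyc^{t x} = u^t`, `t = #μ(ℤ_p) = φ(p^{e₀})`
  (`Literature.NumberTheory.EllipticCurves.torsionOrder`), `γ_cyc = 1 + p^{e₀}` (`Literature.NumberTheory.EllipticCurves.cyclotomicGenerator`); it is a continuous
  homomorphism with `ℓ(γ_cyc^x) = x` and `ker ℓ = μ(ℤ_p)` (Serre II.3.2 Prop. 7–8: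
  `ℤ_pˣ = V × U_1`, `U_1 ≅ ℤ_p` resp. `U_1 = {±1} × U_2`).
* `Literature.CyclotomicZp.zpExtension p : ZpExtension ℚ p`, `κ_cyc = ℓ ∘ χ_p`;
  `isCyclotomic_zpExtension`, `exists_isTopGenerator_zpExtension`.

## References

* J.-P. Serre, *A Course in Arithmetic*, GTM 7 (1973), Ch. II §3.2 (Lemma, Prop. 7, Prop. 8;
  pp. 16–17).
* L. Washington, *Introduction to Cyclotomic Fields*, GTM 83, §13.1 (the cyclotomic
  `ℤ_p`-extension `ℚ_∞`).
* B. Mazur, J. Tate, J. Teitelbaum, Invent. Math. 84 (1986), §I.13 (`γ_cyc`, `T = γ_cyc - 1`).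
-/

noncomputable section

open Filter Topology

namespace Literature.NumberTheory.EllipticCurves.PadicOneUnits

variable {p : ℕ} [Fact p.Prime]

/-- In the discrete valuation ring `ℤ_p`, `‖d‖ ≤ ‖a‖` with `a ≠ 0` forces `a ∣ d`. [folklore] -/
theorem dvd_of_norm_le {a d : ℤ_[p]} (ha : a ≠ 0) (h : ‖d‖ ≤ ‖a‖) : a ∣ d := by
  rw [PadicInt.norm_eq_zpow_neg_valuation ha, PadicInt.norm_le_pow_iff_mem_span_pow,
    Ideal.mem_span_singleton] at h
  rw [PadicInt.unitCoeff_spec ha]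
  exact (Units.isUnit _).mul_left_dvd.mpr h

/-- Conversely `a ∣ d` gives `‖d‖ ≤ ‖a‖` (all of `ℤ_p` has norm `≤ 1`). [folklore] -/
theorem norm_le_of_dvd {a d : ℤ_[p]} (h : a ∣ d) : ‖d‖ ≤ ‖a‖ := by
  obtain ⟨c, rfl⟩ := h
  rw [norm_mul]
  exact mul_le_of_le_one_right (norm_nonneg _) (PadicInt.norm_le_one c)

/-- `r^n → 0` for `‖r‖ < 1`. [folklore] -/
theorem tendsto_pow_of_norm_lt_one {r : ℤ_[p]} (hr : ‖r‖ < 1) :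
    Tendsto (r ^ ·) atTop (𝓝 0) :=
  tendsto_pow_atTop_nhds_zero_of_norm_lt_one hr

/-- **The quadratic congruence `(1 + r)^x ≡ 1 + x r (mod r²)`** for the continuous character
`x ↦ (1 + r)^x` of `ℤ_p` (`‖r‖ < 1`): `‖(1+r)^x - 1 - x r‖ ≤ ‖r‖²`. For `x ∈ ℕ` this is the
binomial theorem (`sq_dvd_add_pow_sub_sub`); the general case follows by density of `ℕ` in `ℤ_p`
and continuity. [folklore] -/
theorem norm_addChar_sub_one_sub_mul_le {r : ℤ_[p]} (hr : ‖r‖ < 1) (x : ℤ_[p]) :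
    ‖PadicInt.addChar_of_value_at_one (p := p) r (tendsto_pow_of_norm_lt_one hr) x - 1 - x * r‖ ≤
      ‖r‖ ^ 2 := by
  set E := PadicInt.addChar_of_value_at_one (p := p) r (tendsto_pow_of_norm_lt_one hr) with hE
  -- the closed set where the estimate holds contains the dense subset `ℕ`
  have hclosed : IsClosed {x : ℤ_[p] | ‖E x - 1 - x * r‖ ≤ ‖r‖ ^ 2} := by
    refine isClosed_le ?_ continuous_const
    have hc : Continuous (E : ℤ_[p] → ℤ_[p]) := PadicInt.continuous_addChar_of_value_at_one _
    fun_prop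
  have hnat : ∀ n : ℕ, ‖E n - 1 - n * r‖ ≤ ‖r‖ ^ 2 := fun n ↦ by
    have hEn : E n = (1 + r) ^ n := by
      rw [show (n : ℤ_[p]) = n • (1 : ℤ_[p]) by simp, AddChar.map_nsmul_eq_pow, hE,
        PadicInt.addChar_of_value_at_one_def]
    rw [hEn, ← norm_pow]
    apply norm_le_of_dvd
    have h := sq_dvd_add_pow_sub_sub r 1 n
    simp only [one_pow, one_mul] at h
    have e : (1 + r) ^ n - 1 - (n : ℤ_[p]) * r = (1 + r) ^ n - r * n - 1 := by ring
    rwa [e]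
  have hsub : Set.range (Nat.cast : ℕ → ℤ_[p]) ⊆ {x : ℤ_[p] | ‖E x - 1 - x * r‖ ≤ ‖r‖ ^ 2} := by
    rintro _ ⟨n, rfl⟩
    exact hnat n
  have hx : x ∈ {x : ℤ_[p] | ‖E x - 1 - x * r‖ ≤ ‖r‖ ^ 2} := by
    apply hclosed.closure_subset_iff.mpr hsub
    rw [PadicInt.denseRange_natCast.closure_range]
    exact Set.mem_univ x
  exact hx


/-! ### The one-parameter subgroup `x ↦ (1 + q)^x`, `q = p^{e+1}` -/

variable (p) in
/-- `‖p^{e+1}‖ < 1` in `ℤ_p`. [folklore] -/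
theorem norm_p_pow_succ_lt_one (e : ℕ) : ‖(p : ℤ_[p]) ^ (e + 1)‖ < 1 := by
  rw [norm_pow]
  have h : ‖(p : ℤ_[p])‖ < 1 := by
    rw [PadicInt.norm_p]; exact inv_lt_one_of_one_lt₀ (by exact_mod_cast (Fact.out : p.Prime).one_lt)
  exact pow_lt_one₀ (norm_nonneg _) h (Nat.succ_ne_zero e)

variable (p) in
/-- **The `p`-adic power `x ↦ (1 + q)^x`**, `q = p^{e+1}`, as a continuous additive character
`ℤ_p → ℤ_p` (Mathlib's `PadicInt.addChar_of_value_at_one`, i.e. the Mahler/binomial series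
`∑ₖ (x choose k) q^k`); for `e + 1 = e₀` (`e₀ = 1` for odd `p`, `2` for `p = 2`) this is the
isomorphism `ℤ_p ≅ 1 + p^{e₀}ℤ_p = \overline{⟨1 + p^{e₀}⟩}` onto the torsion-free part of `ℤ_pˣ`
(Serre, *A Course in Arithmetic*, Ch. II §3.2, Prop. 8: `θ_α : z ↦ α^z`, `α = 1 + p` resp. `5`.)
[cite: Serre1973, Ch. II §3.2 Prop. 8] -/
def oneAddPow (e : ℕ) : AddChar ℤ_[p] ℤ_[p] :=
  PadicInt.addChar_of_value_at_one (p := p) ((p : ℤ_[p]) ^ (e + 1))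
    (tendsto_pow_of_norm_lt_one (norm_p_pow_succ_lt_one p e))

variable (e : ℕ)

/-- `(1 + q)^1 = 1 + q`. [folklore] -/
theorem oneAddPow_one : oneAddPow p e 1 = 1 + (p : ℤ_[p]) ^ (e + 1) :=
  PadicInt.addChar_of_value_at_one_def _

/-- On natural numbers `oneAddPow` is the honest power `(1 + q)^n`. [folklore] -/
theorem oneAddPow_natCast (n : ℕ) : oneAddPow p e n = (1 + (p : ℤ_[p]) ^ (e + 1)) ^ n := by
  rw [show (n : ℤ_[p]) = n • (1 : ℤ_[p]) by simp, AddChar.map_nsmul_eq_pow, oneAddPow_one]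

/-- `x ↦ (1 + q)^x` is continuous. [folklore] -/
theorem continuous_oneAddPow : Continuous (oneAddPow p e : ℤ_[p] → ℤ_[p]) :=
  PadicInt.continuous_addChar_of_value_at_one _

/-- `(1 + q)^x ≡ 1 + x q (mod q²)`: `‖(1+q)^x - 1 - x q‖ ≤ ‖q‖²`. [folklore] -/
theorem norm_oneAddPow_sub_one_sub_mul_le (x : ℤ_[p]) :
    ‖oneAddPow p e x - 1 - x * (p : ℤ_[p]) ^ (e + 1)‖ ≤ ‖(p : ℤ_[p]) ^ (e + 1)‖ ^ 2 :=
  norm_addChar_sub_one_sub_mul_le (norm_p_pow_succ_lt_one p e) x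

/-- `(1 + q)^x ≡ 1 (mod q)`, in particular `‖(1 + q)^x - 1‖ < 1`. [folklore] -/
theorem norm_oneAddPow_sub_one_lt_one (x : ℤ_[p]) : ‖oneAddPow p e x - 1‖ < 1 := by
  have h := norm_oneAddPow_sub_one_sub_mul_le e x
  have hq := norm_p_pow_succ_lt_one p e
  have h1 : ‖x * (p : ℤ_[p]) ^ (e + 1)‖ < 1 := by
    rw [norm_mul]
    exact mul_lt_one_of_nonneg_of_lt_one_right (PadicInt.norm_le_one x) (norm_nonneg _) hq
  have h2 : ‖oneAddPow p e x - 1 - x * (p : ℤ_[p]) ^ (e + 1)‖ < 1 :=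
    h.trans_lt ((sq_lt_one_iff₀ (norm_nonneg _)).mpr hq)
  have e1 : oneAddPow p e x - 1 =
      (oneAddPow p e x - 1 - x * (p : ℤ_[p]) ^ (e + 1)) + x * (p : ℤ_[p]) ^ (e + 1) := by ring
  rw [e1]
  exact (PadicInt.nonarchimedean _ _).trans_lt (max_lt h2 h1)

/-- `(1 + q)^x` is a unit of norm one; in particular it is non-zero. [folklore] -/
theorem norm_oneAddPow (x : ℤ_[p]) : ‖oneAddPow p e x‖ = 1 := by
  have h := norm_oneAddPow_sub_one_lt_one e x
  have e1 : oneAddPow p e x = (oneAddPow p e x - 1) + 1 := by ring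
  rw [e1, PadicInt.norm_add_eq_max_of_ne (by rw [norm_one]; exact h.ne), norm_one]
  exact max_eq_right h.le

/-- **Rescaling**: `(1 + q)^{c x} = (1 + w)^x` with `1 + w = (1 + q)^c` — both sides are continuous
characters of `x` agreeing at `x = 1` (Mathlib `PadicInt.eq_addChar_of_value_at_one`). [folklore] -/
theorem oneAddPow_mul (c x : ℤ_[p]) :
    oneAddPow p e (c * x) = PadicInt.addChar_of_value_at_one (p := p) (oneAddPow p e c - 1)
      (tendsto_pow_of_norm_lt_one (norm_oneAddPow_sub_one_lt_one e c)) x := by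
  have hκ : (oneAddPow p e).compAddMonoidHom (AddMonoidHom.mulLeft c) =
      PadicInt.addChar_of_value_at_one (p := p) (oneAddPow p e c - 1)
        (tendsto_pow_of_norm_lt_one (norm_oneAddPow_sub_one_lt_one e c)) := by
    refine PadicInt.eq_addChar_of_value_at_one _ ?_ ?_
    · exact (continuous_oneAddPow e).comp (continuous_const.mul continuous_id)
    · simp [AddChar.compAddMonoidHom_apply]
  have := congrArg (fun κ : AddChar ℤ_[p] ℤ_[p] ↦ κ x) hκ
  simpa [AddChar.compAddMonoidHom_apply] using this

/-- **The values at `p`-powers**: `(1 + q)^{p^k} = 1 + p^k q (1 + p y)` for some `y ∈ ℤ_p`,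
provided `e + 3 ≤ p (e + 1)` (automatic for odd `p`; `e ≥ 1`, i.e. `4 ∣ q`, for `p = 2`). This is
Mathlib's `exists_one_add_mul_pow_prime_pow_eq` (the engine of `ZMod.orderOf_one_add_mul_prime_pow`).
[folklore] -/
theorem exists_oneAddPow_p_pow (he : e + 3 ≤ p * (e + 1)) (k : ℕ) :
    ∃ y : ℤ_[p], oneAddPow p e ((p : ℤ_[p]) ^ k) =
      1 + (p : ℤ_[p]) ^ k * (p : ℤ_[p]) ^ (e + 1) * (1 + p * y) := by
  have hp : p.Prime := Fact.out
  obtain ⟨y, hy⟩ := ZMod.exists_one_add_mul_pow_prime_pow_eq (R := ℤ_[p])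
    (u := (p : ℤ_[p]) ^ (e + 1)) (v := (p : ℤ_[p])) hp (dvd_pow_self _ (Nat.succ_ne_zero e))
    (by
      rw [← pow_mul, show (p : ℤ_[p]) * (p : ℤ_[p]) ^ (e + 1) * p = (p : ℤ_[p]) ^ (e + 3) by ring]
      exact pow_dvd_pow _ (by nlinarith [he]))
    1 k
  refine ⟨y, ?_⟩
  rw [← Nat.cast_pow, oneAddPow_natCast, Nat.cast_pow]
  simpa using hy

/-- `‖1 + p y‖ = 1`. [folklore] -/
theorem norm_one_add_p_mul (y : ℤ_[p]) : ‖(1 : ℤ_[p]) + p * y‖ = 1 := by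
  have h : ‖(p : ℤ_[p]) * y‖ < 1 := by
    rw [norm_mul, PadicInt.norm_p]
    exact mul_lt_one_of_nonneg_of_lt_one_left (inv_nonneg.mpr (Nat.cast_nonneg _))
      (inv_lt_one_of_one_lt₀ (by exact_mod_cast (Fact.out : p.Prime).one_lt)) (PadicInt.norm_le_one y)
  rw [PadicInt.norm_add_eq_max_of_ne (by rw [norm_one]; exact h.ne'), norm_one]
  exact max_eq_left h.le

/-- **`‖(1 + q)^x - 1‖ = ‖x‖ · ‖q‖`** (`(1+q)^x ≡ 1 + xq` to first order, exactly): the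
`p`-adic logarithm-free form of `v_p((1+q)^x - 1) = v_p(q) + v_p(x)`. Proof: write `x = p^k u` with
`u` a unit; `(1+q)^{p^k u} = (1+w)^u` with `w = p^k q (1 + p y)`, `‖w‖ = ‖p^k‖‖q‖`, and
`(1+w)^u ≡ 1 + u w (mod w²)`. (Serre, *A Course in Arithmetic*, Ch. II §3.2, Lemma before Prop. 8:
"`x ∈ U_n - U_{n+1}` ⇒ `x^p ∈ U_{n+1} - U_{n+2}`", `n ≥ 2` if `p = 2`.) [cite: Serre1973, Ch. II §3.2 Lemma] -/
theorem norm_oneAddPow_sub_one (he : e + 3 ≤ p * (e + 1)) (x : ℤ_[p]) :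
    ‖oneAddPow p e x - 1‖ = ‖x‖ * ‖(p : ℤ_[p]) ^ (e + 1)‖ := by
  by_cases hx : x = 0
  · subst hx
    simp [AddChar.map_zero_eq_one]
  -- `x = u p^k`, `u` a unit
  set k := x.valuation with hk
  set u : ℤ_[p]ˣ := PadicInt.unitCoeff hx with hu
  have hxu : x = (p : ℤ_[p]) ^ k * u := by rw [mul_comm]; exact PadicInt.unitCoeff_spec hx
  obtain ⟨y, hy⟩ := exists_oneAddPow_p_pow e he k
  set w : ℤ_[p] := (p : ℤ_[p]) ^ k * (p : ℤ_[p]) ^ (e + 1) * (1 + p * y) with hw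
  have hw' : oneAddPow p e ((p : ℤ_[p]) ^ k) - 1 = w := by rw [hy]; ring
  have hnw : ‖w‖ = ‖(p : ℤ_[p]) ^ k‖ * ‖(p : ℤ_[p]) ^ (e + 1)‖ := by
    rw [hw, norm_mul, norm_mul, norm_one_add_p_mul, mul_one]
  have hw0 : 0 < ‖w‖ := by
    rw [hnw]
    exact mul_pos (norm_pos_iff.mpr (pow_ne_zero _ (NeZero.ne _)))
      (norm_pos_iff.mpr (pow_ne_zero _ (NeZero.ne _)))
  have hw1 : ‖w‖ < 1 := by
    rw [hnw, norm_pow]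
    exact mul_lt_one_of_nonneg_of_lt_one_right (pow_le_one₀ (norm_nonneg _) (PadicInt.norm_le_one _))
      (norm_nonneg _) (norm_p_pow_succ_lt_one p e)
  -- `(1+q)^x = (1+w)^u ≡ 1 + u w (mod w²)`
  have hresc := oneAddPow_mul e ((p : ℤ_[p]) ^ k) (u : ℤ_[p])
  have hquad := norm_addChar_sub_one_sub_mul_le (p := p)
    (r := oneAddPow p e ((p : ℤ_[p]) ^ k) - 1) (by rw [hw']; exact hw1) (u : ℤ_[p])
  rw [← hresc] at hquad
  simp only [hw'] at hquad
  rw [← hxu] at hquad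
  have huw : ‖(u : ℤ_[p]) * w‖ = ‖w‖ := by rw [norm_mul, PadicInt.norm_units, one_mul]
  have hlt : ‖oneAddPow p e x - 1 - u * w‖ < ‖(u : ℤ_[p]) * w‖ := by
    rw [huw]
    refine hquad.trans_lt ?_
    rw [sq]
    exact mul_lt_of_lt_one_left hw0 hw1
  have e1 : oneAddPow p e x - 1 = (oneAddPow p e x - 1 - u * w) + u * w := by ring
  rw [e1, PadicInt.norm_add_eq_max_of_ne hlt.ne, max_eq_right hlt.le, huw, hnw, hxu, norm_mul,
    PadicInt.norm_units, mul_one]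

/-- **`x ↦ (1 + q)^x` is injective** on `ℤ_p` (`q = p^{e+1}`, `e + 3 ≤ p(e+1)`). [folklore] -/
theorem oneAddPow_injective (he : e + 3 ≤ p * (e + 1)) :
    Function.Injective (oneAddPow p e : ℤ_[p] → ℤ_[p]) := by
  intro x y hxy
  have h1 : oneAddPow p e (x - y) * oneAddPow p e y = oneAddPow p e x := by
    rw [← AddChar.map_add_eq_mul, sub_add_cancel]
  have hy0 : oneAddPow p e y ≠ 0 := by
    rw [← norm_pos_iff, norm_oneAddPow]; exact one_pos
  have h2 : oneAddPow p e (x - y) = 1 := by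
    rw [hxy] at h1
    exact (mul_eq_right₀ hy0).mp h1
  have h3 := norm_oneAddPow_sub_one e he (x - y)
  rw [h2, sub_self, norm_zero, eq_comm, mul_eq_zero] at h3
  rcases h3 with h3 | h3
  · exact sub_eq_zero.mp (norm_eq_zero.mp h3)
  · exact absurd h3 (norm_pos_iff.mpr (pow_ne_zero _ (NeZero.ne _))).ne'


/-- `‖q‖ ≤ ‖p‖` for `q = p^{e+1}`. [folklore] -/
theorem norm_q_le_norm_p : ‖(p : ℤ_[p]) ^ (e + 1)‖ ≤ ‖(p : ℤ_[p])‖ := by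
  rw [pow_succ, norm_mul]
  exact mul_le_of_le_one_left (norm_nonneg _) (PadicInt.norm_le_one _)

/-- **Successive approximation**: every `u ≡ 1 (mod q)` is approximated by values `(1+q)^x` to
any `p`-adic precision: `∀ m, ∃ x, ‖(1+q)^x - u‖ ≤ ‖p^m‖‖q‖`. Step `m → m+1`: with `d = (1+q)^x - u`,
`w = (1+q)^{p^m} - 1` (`‖w‖ = ‖p^m q‖ ≥ ‖d‖`) and `a = -d/(uw)`, one has
`(1+q)^{x + p^m a} - u = d a w + (u + d)·((1+w)^a - 1 - a w)`, of norm `≤ ‖w‖² ≤ ‖p^{m+1} q‖`.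
[folklore] -/
theorem exists_norm_oneAddPow_sub_le (he : e + 3 ≤ p * (e + 1)) {u : ℤ_[p]}
    (hu : ‖u - 1‖ ≤ ‖(p : ℤ_[p]) ^ (e + 1)‖) (m : ℕ) :
    ∃ x : ℤ_[p], ‖oneAddPow p e x - u‖ ≤ ‖(p : ℤ_[p]) ^ m‖ * ‖(p : ℤ_[p]) ^ (e + 1)‖ := by
  have hq1 := norm_p_pow_succ_lt_one p e
  have hu1 : ‖u‖ = 1 := by
    have e1 : u = (u - 1) + 1 := by ring
    have hlt : ‖u - 1‖ < ‖(1 : ℤ_[p])‖ := by rw [norm_one]; exact hu.trans_lt hq1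
    rw [e1, PadicInt.norm_add_eq_max_of_ne hlt.ne, max_eq_right hlt.le, norm_one]
  have hu0 : u ≠ 0 := by rw [← norm_pos_iff, hu1]; exact one_pos
  induction m with
  | zero => exact ⟨0, by simpa [AddChar.map_zero_eq_one, norm_sub_rev] using hu⟩
  | succ m ih =>
    obtain ⟨x, hx⟩ := ih
    obtain ⟨y, hy⟩ := exists_oneAddPow_p_pow e he m
    set d := oneAddPow p e x - u with hd
    set w : ℤ_[p] := (p : ℤ_[p]) ^ m * (p : ℤ_[p]) ^ (e + 1) * (1 + p * y) with hw
    have hw' : oneAddPow p e ((p : ℤ_[p]) ^ m) - 1 = w := by rw [hy]; ring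
    have hnw : ‖w‖ = ‖(p : ℤ_[p]) ^ m‖ * ‖(p : ℤ_[p]) ^ (e + 1)‖ := by
      rw [hw, norm_mul, norm_mul, norm_one_add_p_mul, mul_one]
    have hw0 : w ≠ 0 := by
      rw [← norm_pos_iff, hnw]
      exact mul_pos (norm_pos_iff.mpr (pow_ne_zero _ (NeZero.ne _)))
        (norm_pos_iff.mpr (pow_ne_zero _ (NeZero.ne _)))
    have hw1 : ‖w‖ < 1 := by
      rw [hnw, norm_pow]
      exact mul_lt_one_of_nonneg_of_lt_one_right (pow_le_one₀ (norm_nonneg _)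
        (PadicInt.norm_le_one _)) (norm_nonneg _) hq1
    -- `a = -d/(uw)`
    have hdvd : u * w ∣ d := dvd_of_norm_le (mul_ne_zero hu0 hw0)
      (by rw [norm_mul, hu1, one_mul, hnw]; exact hx)
    obtain ⟨a₀, ha₀⟩ := hdvd
    refine ⟨x + (p : ℤ_[p]) ^ m * (-a₀), ?_⟩
    -- `(1+q)^{x + p^m a} = (u + d)(1 + a w + err)`
    have hresc := oneAddPow_mul e ((p : ℤ_[p]) ^ m) (-a₀)
    have hquad := norm_addChar_sub_one_sub_mul_le (p := p)
      (r := oneAddPow p e ((p : ℤ_[p]) ^ m) - 1) (by rw [hw']; exact hw1) (-a₀)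
    rw [← hresc] at hquad
    simp only [hw'] at hquad
    set err := oneAddPow p e ((p : ℤ_[p]) ^ m * -a₀) - 1 - -a₀ * w with herr
    have hEx : oneAddPow p e x = u + d := by rw [hd]; ring
    have key : oneAddPow p e (x + (p : ℤ_[p]) ^ m * -a₀) - u = d * (-a₀) * w + (u + d) * err := by
      rw [AddChar.map_add_eq_mul, hEx, herr, ha₀]; ring
    rw [key]
    -- both terms have norm `≤ ‖w‖² ≤ ‖p^{m+1}‖‖q‖`
    have hww : ‖w‖ * ‖w‖ ≤ ‖(p : ℤ_[p]) ^ (m + 1)‖ * ‖(p : ℤ_[p]) ^ (e + 1)‖ := by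
      have hle : ‖(p : ℤ_[p]) ^ m‖ * ‖(p : ℤ_[p]) ^ (e + 1)‖ ≤ ‖(p : ℤ_[p])‖ :=
        (mul_le_of_le_one_left (norm_nonneg _) (PadicInt.norm_le_one _)).trans (norm_q_le_norm_p e)
      calc ‖w‖ * ‖w‖ ≤ ‖w‖ * ‖(p : ℤ_[p])‖ := by
            nth_rw 2 [hnw]; exact mul_le_mul_of_nonneg_left hle (norm_nonneg _)
        _ = ‖(p : ℤ_[p]) ^ (m + 1)‖ * ‖(p : ℤ_[p]) ^ (e + 1)‖ := by
            rw [hnw]; simp only [norm_pow]; ring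
    have hd' : ‖d‖ ≤ ‖w‖ := by rw [hnw]; exact hx
    have h1 : ‖d * -a₀ * w‖ ≤ ‖w‖ * ‖w‖ := by
      rw [norm_mul, norm_mul]
      refine mul_le_mul_of_nonneg_right ?_ (norm_nonneg _)
      exact (mul_le_of_le_one_right (norm_nonneg _) (PadicInt.norm_le_one _)).trans hd'
    have h2 : ‖(u + d) * err‖ ≤ ‖w‖ * ‖w‖ := by
      rw [norm_mul, ← sq]
      exact (mul_le_of_le_one_left (norm_nonneg _) (PadicInt.norm_le_one _)).trans hquad
    exact (PadicInt.nonarchimedean _ _).trans ((max_le h1 h2).trans hww)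

/-- **`x ↦ (1 + q)^x` maps `ℤ_p` onto `1 + qℤ_p`** (`q = p^{e+1}`, `e + 3 ≤ p(e+1)`): the range is
compact, hence closed, and dense in `1 + qℤ_p` by `exists_norm_oneAddPow_sub_le`.
(Serre, *A Course in Arithmetic*, Ch. II §3.2, Prop. 8: `U_1 ≅ ℤ_p` for `p ≠ 2`, `U_2 ≅ ℤ_2`.)
[cite: Serre1973, Ch. II §3.2 Prop. 8] -/
theorem exists_oneAddPow_eq (he : e + 3 ≤ p * (e + 1)) {u : ℤ_[p]}
    (hu : ‖u - 1‖ ≤ ‖(p : ℤ_[p]) ^ (e + 1)‖) : ∃ x : ℤ_[p], oneAddPow p e x = u := by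
  have hclosed : IsClosed (Set.range (oneAddPow p e : ℤ_[p] → ℤ_[p])) :=
    (isCompact_range (continuous_oneAddPow e)).isClosed
  have hmem : u ∈ closure (Set.range (oneAddPow p e : ℤ_[p] → ℤ_[p])) := by
    refine Metric.mem_closure_iff.mpr fun ε hε ↦ ?_
    obtain ⟨m, hm⟩ := PadicInt.exists_pow_neg_lt p hε
    obtain ⟨x, hx⟩ := exists_norm_oneAddPow_sub_le e he hu m
    refine ⟨oneAddPow p e x, ⟨x, rfl⟩, ?_⟩
    rw [dist_eq_norm, norm_sub_rev]
    refine lt_of_le_of_lt (hx.trans ?_) hm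
    rw [PadicInt.norm_p_pow]
    exact mul_le_of_le_one_right (zpow_nonneg (Nat.cast_nonneg _) _) (PadicInt.norm_le_one _)
  rw [hclosed.closure_eq] at hmem
  obtain ⟨x, hx⟩ := hmem
  exact ⟨x, hx⟩

end Literature.NumberTheory.EllipticCurves.PadicOneUnits

open Field



-- The `ℚ`-algebra diamond on `AlgebraicClosure ℚ` (`DivisionRing.toRatAlgebra` vs
-- `AlgebraicClosure.instAlgebra`, defeq but not at instance transparency): the absolute Galois
-- group and the cyclotomic character are keyed on the latter.
attribute [-instance] DivisionRing.toRatAlgebra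

namespace Literature.NumberTheory.EllipticCurves
section GaloisRep
open Literature.NumberTheory.GaloisRepresentations (GaloisRep)
open Literature.NumberTheory.GaloisRepresentations.GaloisRep

variable (p : ℕ) [Fact p.Prime]

/-- **Level-`p^n` surjectivity of the cyclotomic character of `ℚ`**: for `c` prime to `p` there
is `σ ∈ Γ_ℚ` acting on `μ_{p^n} ⊂ ℚ̄` by `ζ ↦ ζ^c`, i.e. `χ_p(σ) ≡ c (mod p^n)`. Proof: `ζ` and `ζ^c`
are both roots of the irreducible `Φ_{p^n} ∈ ℚ[X]` (Mathlib `Polynomial.cyclotomic_eq_minpoly_rat`),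
hence conjugate under `Gal(ℚ̄/ℚ)` (`Normal.minpoly_eq_iff_mem_orbit`). (Washington, *Introduction to
Cyclotomic Fields*, Thm 2.5: `Gal(ℚ(ζ_n)/ℚ) ≅ (ℤ/n)ˣ`.) [folklore] -/
theorem _root_.Literature.NumberTheory.GaloisRepresentations.GaloisRep.exists_cyclotomicCharacter_toZModPow_eq (n c : ℕ) (hc : c.Coprime (p ^ n)) :
    ∃ σ : absoluteGaloisGroup ℚ,
      ((GaloisRep.cyclotomicCharacter ℚ p σ : ℤ_[p]ˣ) : ℤ_[p]).toZModPow n = (c : ZMod (p ^ n)) := by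
  haveI : NeZero ((p ^ n : ℕ) : AlgebraicClosure ℚ) :=
    ⟨by exact_mod_cast pow_ne_zero n (Fact.out : p.Prime).ne_zero⟩
  obtain ⟨ζ, hζ⟩ := HasEnoughRootsOfUnity.exists_primitiveRoot (AlgebraicClosure ℚ) (p ^ n)
  have hpos : 0 < p ^ n := pow_pos (Fact.out : p.Prime).pos n
  have hζc : IsPrimitiveRoot (ζ ^ c) (p ^ n) := hζ.pow_of_coprime c hc
  -- same minimal polynomial `Φ_{p^n}` over `ℚ`
  have h1 := Polynomial.cyclotomic_eq_minpoly_rat hζc hpos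
  have h2 := Polynomial.cyclotomic_eq_minpoly_rat hζ hpos
  have hmin : minpoly ℚ (ζ ^ c) = minpoly ℚ ζ := h1.symm.trans h2
  obtain ⟨σ, hσ⟩ := (Normal.minpoly_eq_iff_mem_orbit (F := ℚ) (E := AlgebraicClosure ℚ)).mp hmin
  refine ⟨σ, ?_⟩
  have hspec := cyclotomicCharacter_spec ℚ p (k := n) σ ζ hζ.pow_eq_one
  have hσ' : σ ζ = ζ ^ c := hσ
  change σ ζ = _ at hspec
  rw [hσ'] at hspec
  -- exponents agree modulo the order `p^n` of `ζ`
  have hmod : ζ ^ (c % p ^ n) = ζ ^ c := by rw [hζ.eq_orderOf, pow_mod_orderOf]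
  rw [← hmod] at hspec
  have hval := hζ.pow_inj (Nat.mod_lt _ hpos) (ZMod.val_lt _) hspec
  rw [← ZMod.natCast_zmod_val (((GaloisRep.cyclotomicCharacter ℚ p σ : ℤ_[p]ˣ) : ℤ_[p]).toZModPow n),
    ← hval, ZMod.natCast_mod]


/-- **The `p`-adic cyclotomic character of `ℚ` is surjective** (`Gal(ℚ(μ_{p^∞})/ℚ) ≅ ℤ_pˣ`,
i.e. irreducibility of the `p^n`-th cyclotomic polynomials over `ℚ`; Washington Thm 2.5 / §13.1).
Proof: level `p^n` (`exists_cyclotomicCharacter_toZModPow_eq`) gives non-empty closed sets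
`S_n = {σ | χ_p σ ≡ u (mod p^n)}`, decreasing in `n`; Cantor's intersection theorem in the compact
group `Γ_ℚ` gives `σ` with `χ_p σ = u`. [folklore] -/
theorem _root_.Literature.NumberTheory.GaloisRepresentations.GaloisRep.cyclotomicCharacter_rat_surjective :
    Function.Surjective (GaloisRep.cyclotomicCharacter ℚ p) := by
  intro u
  haveI : CompactSpace (absoluteGaloisGroup ℚ) :=
    inferInstanceAs (CompactSpace (AlgebraicClosure ℚ ≃ₐ[ℚ] AlgebraicClosure ℚ))
  -- the closed sets `S n = {σ | χ σ ≡ u mod p^n}`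
  let S : ℕ → Set (absoluteGaloisGroup ℚ) := fun n ↦
    {σ | ((GaloisRep.cyclotomicCharacter ℚ p σ : ℤ_[p]ˣ) : ℤ_[p]) - u ∈ Ideal.span {(p : ℤ_[p]) ^ n}}
  have hanti : ∀ n, S (n + 1) ⊆ S n := fun n σ hσ ↦ by
    have hle : Ideal.span {(p : ℤ_[p]) ^ (n + 1)} ≤ Ideal.span {(p : ℤ_[p]) ^ n} :=
      Ideal.span_singleton_le_span_singleton.mpr (pow_dvd_pow _ n.le_succ)
    exact hle hσ
  have hne : ∀ n, (S n).Nonempty := fun n ↦ by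
    have hc : (((u : ℤ_[p]ˣ) : ℤ_[p]).toZModPow n).val.Coprime (p ^ n) := by
      have := ZMod.val_coe_unit_coprime (Units.map (PadicInt.toZModPow n).toMonoidHom u)
      simpa using this
    obtain ⟨σ, hσ⟩ := exists_cyclotomicCharacter_toZModPow_eq p n _ hc
    refine ⟨σ, ?_⟩
    simp only [S, Set.mem_setOf_eq]
    rw [← PadicInt.ker_toZModPow, RingHom.mem_ker, map_sub, hσ, sub_eq_zero]
    exact ZMod.natCast_zmod_val _
  have hclosed : ∀ n, IsClosed (S n) := fun n ↦ by
    have hS : S n = (fun σ ↦ ‖((GaloisRep.cyclotomicCharacter ℚ p σ : ℤ_[p]ˣ) : ℤ_[p]) - u‖) ⁻¹'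
        Set.Iic ((p : ℝ) ^ (-(n : ℤ))) := by
      ext σ
      simp only [S, Set.mem_setOf_eq, Set.mem_preimage, Set.mem_Iic]
      exact (PadicInt.norm_le_pow_iff_mem_span_pow _ n).symm
    rw [hS]
    refine IsClosed.preimage ?_ isClosed_Iic
    exact continuous_norm.comp ((Units.continuous_val.comp
      (map_continuous (GaloisRep.cyclotomicCharacter ℚ p))).sub continuous_const)
  obtain ⟨σ, hσ⟩ := IsCompact.nonempty_iInter_of_sequence_nonempty_isCompact_isClosed S hanti
    hne (hclosed 0).isCompact hclosed
  refine ⟨σ, Units.ext (PadicInt.ext_of_toZModPow.mp fun n ↦ ?_)⟩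
  have hn : ((GaloisRep.cyclotomicCharacter ℚ p σ : ℤ_[p]ˣ) : ℤ_[p]) - u ∈ Ideal.span {(p : ℤ_[p]) ^ n} :=
    Set.mem_iInter.mp hσ n
  rwa [← PadicInt.ker_toZModPow, RingHom.mem_ker, map_sub, sub_eq_zero] at hn

end GaloisRep
end Literature.NumberTheory.EllipticCurves

/-! ### The normalised logarithm `ℓ : ℤ_pˣ → ℤ_p` and the cyclotomic `ℤ_p`-extension of `ℚ` -/

namespace Literature.NumberTheory.EllipticCurves.CyclotomicZp

open PadicOneUnits

variable (p : ℕ) [Fact p.Prime]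

omit [Fact p.Prime] in
/-- `e₀ = (e₀ - 1) + 1` (`e₀ = cyclotomicExponent p ≥ 1`). [folklore] -/
theorem cyclotomicExponent_eq_succ : cyclotomicExponent p = (cyclotomicExponent p - 1) + 1 := by
  unfold cyclotomicExponent; split_ifs <;> rfl

/-- The numerical condition `e + 3 ≤ p (e + 1)` of `Literature.PadicOneUnits` at `e + 1 = e₀` (`3 ≤ p` for
odd `p`; `4 ≤ 4` for `p = 2`, `e₀ = 2`). [folklore] -/
theorem cyclotomicExponent_cond :
    (cyclotomicExponent p - 1) + 3 ≤ p * ((cyclotomicExponent p - 1) + 1) := by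
  unfold cyclotomicExponent
  split_ifs with h
  · subst h; norm_num
  · have h2 := (Fact.out : p.Prime).two_le
    omega

/-- **`x ↦ γ_cyc^x = (1 + p^{e₀})^x`**, the isomorphism `ℤ_p ≅ 1 + p^{e₀}ℤ_p` onto the torsion-free
part of `ℤ_pˣ` (`Literature.NumberTheory.EllipticCurves.PadicOneUnits.oneAddPow` at `e + 1 = e₀`; Serre, *A Course in Arithmetic*,
II.3.2 Prop. 8; Mazur–Tate–Teitelbaum 1986, §I.13). [folklore] -/
def cycPow : AddChar ℤ_[p] ℤ_[p] := oneAddPow p (cyclotomicExponent p - 1)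

/-- `γ_cyc^1 = γ_cyc = 1 + p^{e₀}`. [folklore] -/
theorem cycPow_one : cycPow p 1 = (cyclotomicGenerator p : ℤ_[p]) := by
  rw [cycPow, oneAddPow_one, ← cyclotomicExponent_eq_succ, cyclotomicGenerator]
  push_cast
  ring

/-- `‖γ_cyc^x‖ = 1`. [folklore] -/
theorem norm_cycPow (x : ℤ_[p]) : ‖cycPow p x‖ = 1 := norm_oneAddPow _ x

/-- `γ_cyc^x` as a unit of `ℤ_p`. [folklore] -/
def cycPowUnit (x : ℤ_[p]) : ℤ_[p]ˣ := (PadicInt.isUnit_iff.mpr (norm_cycPow p x)).unit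

/-- Unfolding: the value of the unit `γ_cyc^x`. [folklore] -/
@[simp] theorem val_cycPowUnit (x : ℤ_[p]) : (cycPowUnit p x : ℤ_[p]) = cycPow p x := rfl

/-- `x ↦ γ_cyc^x` is injective. [folklore] -/
theorem cycPow_injective : Function.Injective (cycPow p : ℤ_[p] → ℤ_[p]) :=
  oneAddPow_injective _ (cyclotomicExponent_cond p)

/-- `x ↦ γ_cyc^x` is onto `1 + p^{e₀}ℤ_p`. [folklore] -/
theorem exists_cycPow_eq {u : ℤ_[p]} (hu : ‖u - 1‖ ≤ ‖(p : ℤ_[p]) ^ cyclotomicExponent p‖) :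
    ∃ x, cycPow p x = u := by
  rw [cyclotomicExponent_eq_succ] at hu
  exact exists_oneAddPow_eq _ (cyclotomicExponent_cond p) hu

/-- `u ≡ 1 (mod p^n)`, i.e. `‖u - 1‖ ≤ ‖p^n‖`, from `u mod p^n = 1`. [folklore] -/
theorem norm_sub_one_le_of_toZModPow_eq_one {u : ℤ_[p]} {n : ℕ}
    (h : PadicInt.toZModPow n u = 1) : ‖u - 1‖ ≤ ‖(p : ℤ_[p]) ^ n‖ := by
  rw [PadicInt.norm_p_pow, PadicInt.norm_le_pow_iff_mem_span_pow, ← PadicInt.ker_toZModPow,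
    RingHom.mem_ker, map_sub, h, map_one, sub_self]

/-- **`u^t ∈ γ_cyc^{t ℤ_p}`** for every unit `u`, `t = #μ(ℤ_p)` (`= p - 1` for odd `p`, `2` for
`p = 2`): for odd `p`, `u^{p-1} ≡ 1 (mod p)` lies in `1 + pℤ_p = γ_cyc^{ℤ_p}` and `p - 1` is a unit of
`ℤ_p`; for `p = 2`, `±u ∈ 1 + 4ℤ_2 = 5^{ℤ_2}` and `u² = (±u)²`. (Serre, *A Course in Arithmetic*,
II.3.2 Prop. 7–8: `ℤ_pˣ = V × U_1`, `U_1 ≅ ℤ_p` resp. `U_1 = {±1} × U_2`.) [folklore] -/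
theorem exists_cycPow_torsionOrder_mul_eq (u : ℤ_[p]ˣ) :
    ∃ x, cycPow p (torsionOrder p * x) = (u : ℤ_[p]) ^ torsionOrder p := by
  have hp : p.Prime := Fact.out
  -- `u^t ≡ 1 (mod p^{e₀})` (Euler)
  have ht : ‖(u : ℤ_[p]) ^ torsionOrder p - 1‖ ≤ ‖(p : ℤ_[p]) ^ cyclotomicExponent p‖ := by
    apply norm_sub_one_le_of_toZModPow_eq_one
    have h := Units.ext_iff.mp
      (ZMod.pow_totient (Units.map (PadicInt.toZModPow (cyclotomicExponent p)).toMonoidHom u))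
    simp only [Units.val_pow_eq_pow_val, Units.coe_map, Units.val_one] at h
    show PadicInt.toZModPow _ ((u : ℤ_[p]) ^ Nat.totient (p ^ cyclotomicExponent p)) = 1
    rw [map_pow]
    exact h
  by_cases h2 : p = 2
  · subst h2
    have he : cyclotomicExponent 2 = 2 := by unfold cyclotomicExponent; simp
    have htor : torsionOrder 2 = 2 := by rw [torsionOrder, he]; decide
    -- `u ≡ ±1 (mod 4)`
    have hdec : ∀ v v' : ZMod (2 ^ 2), v * v' = 1 → v = 1 ∨ v = -1 := by decide
    have hcases := hdec (PadicInt.toZModPow 2 (u : ℤ_[2])) (PadicInt.toZModPow 2 (↑u⁻¹ : ℤ_[2]))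
      (by rw [← map_mul, Units.mul_inv, map_one])
    rcases hcases with h1 | h1
    · obtain ⟨y, hy⟩ := exists_cycPow_eq 2 (u := u)
        (by rw [he]; exact norm_sub_one_le_of_toZModPow_eq_one 2 h1)
      refine ⟨y, ?_⟩
      rw [htor, Nat.cast_ofNat, two_mul, AddChar.map_add_eq_mul, hy, sq]
    · obtain ⟨y, hy⟩ := exists_cycPow_eq 2 (u := -u)
        (by rw [he]; exact norm_sub_one_le_of_toZModPow_eq_one 2 (by rw [map_neg, h1, neg_neg]))
      refine ⟨y, ?_⟩
      rw [htor, Nat.cast_ofNat, two_mul, AddChar.map_add_eq_mul, hy]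
      ring
  · -- odd `p`: `t = p - 1` is a unit of `ℤ_p`
    have he : cyclotomicExponent p = 1 := by unfold cyclotomicExponent; simp [h2]
    have htor : torsionOrder p = p - 1 := by rw [torsionOrder, he, pow_one, Nat.totient_prime hp]
    obtain ⟨y, hy⟩ := exists_cycPow_eq p ht
    have hunit : IsUnit ((torsionOrder p : ℕ) : ℤ_[p]) := by
      rw [PadicInt.isUnit_iff, htor]
      exact PadicInt.norm_natCast_p_sub_one
    obtain ⟨t, ht'⟩ := hunit
    refine ⟨t⁻¹ * y, ?_⟩
    rw [← ht', ← mul_assoc, Units.mul_inv, one_mul, hy]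

/-- Uniqueness in `exists_cycPow_torsionOrder_mul_eq`: `x ↦ γ_cyc^{t x}` is injective (`t ≠ 0` in
the domain `ℤ_p`). [folklore] -/
theorem cycPow_torsionOrder_mul_injective :
    Function.Injective fun x : ℤ_[p] ↦ cycPow p (torsionOrder p * x) := by
  intro x y hxy
  have h := cycPow_injective p hxy
  have ht : ((torsionOrder p : ℕ) : ℤ_[p]) ≠ 0 := by
    have : 0 < torsionOrder p := Nat.totient_pos.mpr (pow_pos (Fact.out : p.Prime).pos _)
    exact_mod_cast this.ne'
  exact mul_left_cancel₀ ht h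

/-- **The normalised `p`-adic logarithm `ℓ : ℤ_pˣ → ℤ_p`**: `ℓ(u)` is the unique `x ∈ ℤ_p` with
`γ_cyc^{t x} = u^t` (`t = #μ(ℤ_p)`), i.e. `ℓ = log_p / log_p(γ_cyc)`, `ℓ(γ_cyc) = 1`, `ker ℓ = μ(ℤ_p)`;
equivalently the projection `ℤ_pˣ = μ × \overline{⟨γ_cyc⟩} → \overline{⟨γ_cyc⟩} ≅ ℤ_p`
(Serre, *A Course in Arithmetic*, II.3.2 Prop. 7–8; Washington §13.1; MTT §I.13).
Relation to the tree: `ℓ u = Literature.padicLog p u / Literature.padicLog p γ_cyc` for the Iwasawa logarithm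
`Literature.NumberTheory.EllipticCurves.padicLog` of `PAdicHeights`, but the multiplicativity and the kernel of `log_p` are only named
facts there (`Literature.NumberTheory.EllipticCurves.padicLog_mul`, `Literature.NumberTheory.EllipticCurves.padicLog_eq_zero_iff`), so `ℓ` is built directly from the
exponential `x ↦ γ_cyc^x` (`cycPow`) to keep the present construction unconditional. [folklore] -/
def ell (u : ℤ_[p]ˣ) : ℤ_[p] := Classical.choose (exists_cycPow_torsionOrder_mul_eq p u)

/-- Defining property of `ℓ`: `γ_cyc^{t ℓ(u)} = u^t`. [folklore] -/
theorem cycPow_torsionOrder_mul_ell (u : ℤ_[p]ˣ) :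
    cycPow p (torsionOrder p * ell p u) = (u : ℤ_[p]) ^ torsionOrder p :=
  Classical.choose_spec (exists_cycPow_torsionOrder_mul_eq p u)

/-- Characterisation of `ℓ u`. [folklore] -/
theorem ell_eq_iff (u : ℤ_[p]ˣ) (x : ℤ_[p]) :
    ell p u = x ↔ cycPow p (torsionOrder p * x) = (u : ℤ_[p]) ^ torsionOrder p := by
  constructor
  · rintro rfl; exact cycPow_torsionOrder_mul_ell p u
  · intro h
    exact cycPow_torsionOrder_mul_injective p ((cycPow_torsionOrder_mul_ell p u).trans h.symm)

/-- `ℓ` is a homomorphism. [folklore] -/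
theorem ell_mul (u v : ℤ_[p]ˣ) : ell p (u * v) = ell p u + ell p v := by
  rw [ell_eq_iff, mul_add, AddChar.map_add_eq_mul, cycPow_torsionOrder_mul_ell,
    cycPow_torsionOrder_mul_ell, Units.val_mul, mul_pow]

/-- `ℓ(1) = 0`. [folklore] -/
theorem ell_one : ell p 1 = 0 := by
  rw [ell_eq_iff, mul_zero, AddChar.map_zero_eq_one, Units.val_one, one_pow]

/-- **`ℓ(γ_cyc^x) = x`**; in particular `ℓ(γ_cyc) = 1` and `ℓ` is onto. [folklore] -/
theorem ell_cycPowUnit (x : ℤ_[p]) : ell p (cycPowUnit p x) = x := by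
  rw [ell_eq_iff, val_cycPowUnit, ← AddChar.map_nsmul_eq_pow, nsmul_eq_mul]

/-- **`ker ℓ = μ(ℤ_p)`**: `ℓ u = 0 ↔ u` has finite order. [folklore] -/
theorem ell_eq_zero_iff (u : ℤ_[p]ˣ) : ell p u = 0 ↔ IsOfFinOrder u := by
  have htpos : 0 < torsionOrder p := Nat.totient_pos.mpr (pow_pos (Fact.out : p.Prime).pos _)
  rw [ell_eq_iff, mul_zero, AddChar.map_zero_eq_one, isOfFinOrder_iff_pow_eq_one]
  constructor
  · intro h
    exact ⟨torsionOrder p, htpos, Units.ext (by rw [Units.val_pow_eq_pow_val, ← h, Units.val_one])⟩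
  · rintro ⟨n, hn, hun⟩
    -- `γ^{t ℓ(u) n} = u^{t n} = 1 = γ^0`
    have h1 : cycPow p (torsionOrder p * ell p u * n) = 1 := by
      rw [← nsmul_eq_mul', AddChar.map_nsmul_eq_pow, cycPow_torsionOrder_mul_ell, ← pow_mul,
        mul_comm, pow_mul, ← Units.val_pow_eq_pow_val, hun, Units.val_one, one_pow]
    have h2 : torsionOrder p * ell p u * n = 0 := by
      apply cycPow_injective p
      rw [h1, AddChar.map_zero_eq_one]
    have hn0 : ((n : ℕ) : ℤ_[p]) ≠ 0 := by exact_mod_cast hn.ne'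
    have ht0 : ((torsionOrder p : ℕ) : ℤ_[p]) ≠ 0 := by exact_mod_cast htpos.ne'
    have h3 : ell p u = 0 := by
      rcases mul_eq_zero.mp h2 with h | h
      · rcases mul_eq_zero.mp h with h' | h'
        · exact absurd h' ht0
        · exact h'
      · exact absurd h hn0
    have h4 := cycPow_torsionOrder_mul_ell p u
    rwa [h3, mul_zero, AddChar.map_zero_eq_one] at h4

/-- `ℓ` is continuous: `x ↦ γ_cyc^{t x}` is a closed embedding of the compact space `ℤ_p`
(continuous and injective), and its composite with `ℓ` is the continuous map `u ↦ u^t`. [folklore] -/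
theorem continuous_ell : Continuous (ell p) := by
  have hF : Topology.IsClosedEmbedding fun x : ℤ_[p] ↦ cycPow p (torsionOrder p * x) :=
    Continuous.isClosedEmbedding
      ((continuous_oneAddPow _).comp (continuous_const.mul continuous_id))
      (cycPow_torsionOrder_mul_injective p)
  rw [hF.isEmbedding.continuous_iff]
  have h : (fun x : ℤ_[p] ↦ cycPow p (torsionOrder p * x)) ∘ ell p =
      fun u : ℤ_[p]ˣ ↦ (u : ℤ_[p]) ^ torsionOrder p := by
    funext u; exact cycPow_torsionOrder_mul_ell p u
  rw [h]
  exact Units.continuous_val.pow _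

/-- `ℓ` as a continuous homomorphism `ℤ_pˣ →ₜ* ℤ_p` (target written multiplicatively). [folklore] -/
def ellHom : ℤ_[p]ˣ →ₜ* Multiplicative ℤ_[p] where
  toFun u := Multiplicative.ofAdd (ell p u)
  map_one' := by rw [ell_one]; rfl
  map_mul' u v := by rw [ell_mul, ofAdd_add]
  continuous_toFun := continuous_ofAdd.comp (continuous_ell p)

/-- Unfolding lemma for `ellHom`. [folklore] -/
@[simp] theorem ellHom_apply (u : ℤ_[p]ˣ) : ellHom p u = Multiplicative.ofAdd (ell p u) := rfl

end Literature.NumberTheory.EllipticCurves.CyclotomicZp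

/-! ### The cyclotomic `ℤ_p`-extension `κ_cyc = ℓ ∘ χ_p` of `ℚ` -/

namespace Literature.NumberTheory.EllipticCurves.CyclotomicZp

variable (p : ℕ) [Fact p.Prime]

/-- **The (normalised) cyclotomic `ℤ_p`-extension of `ℚ`**: `κ_cyc = ℓ ∘ χ_p : Γ_ℚ →ₜ* ℤ_p`,
`ℓ = log_p/log_p(γ_cyc)` the normalised logarithm (`ell`) and `χ_p` the `p`-adic cyclotomic
character; `ker κ_cyc = χ_p⁻¹(μ(ℤ_p))` cuts out `ℚ_∞ ⊆ ℚ(μ_{p^∞})`, and `κ_cyc(γ) = 1` for any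
`γ` with `χ_p(γ) = γ_cyc = 1 + p^{e₀}`. Surjectivity: `χ_p` is onto (`cyclotomicCharacter_rat_surjective`)
and `ℓ(γ_cyc^x) = x`. (Washington, *Introduction to Cyclotomic Fields*, §13.1;
Mazur–Tate–Teitelbaum 1986, §I.13.) [cite: Washington1997, §13.1] -/
def zpExtension : ZpExtension ℚ p where
  toContinuousMonoidHom := (ellHom p).comp (GaloisRepresentations.GaloisRep.cyclotomicCharacter ℚ p)
  surjective := by
    intro y
    obtain ⟨σ, hσ⟩ := GaloisRepresentations.GaloisRep.cyclotomicCharacter_rat_surjective p (cycPowUnit p y.toAdd)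
    refine ⟨σ, ?_⟩
    change ellHom p (GaloisRepresentations.GaloisRep.cyclotomicCharacter ℚ p σ) = y
    rw [hσ, ellHom_apply, ell_cycPowUnit, ofAdd_toAdd]

/-- Unfolding: `κ_cyc σ = ℓ(χ_p σ)`. [folklore] -/
theorem zpExtension_apply (σ : absoluteGaloisGroup ℚ) :
    zpExtension p σ = Multiplicative.ofAdd (ell p (GaloisRepresentations.GaloisRep.cyclotomicCharacter ℚ p σ)) := rfl

/-- **`κ_cyc` is cyclotomic**: `ker κ_cyc = χ_p⁻¹(μ(ℤ_p))` (`ker ℓ = μ(ℤ_p)`).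
[cite: Washington1997, §13.1] -/
theorem isCyclotomic_zpExtension : (zpExtension p).IsCyclotomic := by
  ext σ
  rw [ZpExtension.mem_kerSubgroup, Subgroup.mem_comap, CommGroup.mem_torsion, zpExtension_apply,
    ofAdd_eq_one, ell_eq_zero_iff]
  rfl

/-- **A normalised topological generator**: there is `γ ∈ Γ_ℚ` with `χ_p(γ) = γ_cyc = 1 + p^{e₀}`
(surjectivity of `χ_p`), and then `κ_cyc(γ) = ℓ(γ_cyc) = 1`. [cite: Washington1997, §13.1] -/
theorem exists_isTopGenerator_zpExtension :
    ∃ γ : absoluteGaloisGroup ℚ, (zpExtension p).IsTopGenerator γ ∧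
      ((GaloisRepresentations.GaloisRep.cyclotomicCharacter ℚ p γ : ℤ_[p]ˣ) : ℤ_[p]) = (cyclotomicGenerator p : ℤ_[p]) := by
  obtain ⟨γ, hγ⟩ := GaloisRepresentations.GaloisRep.cyclotomicCharacter_rat_surjective p (cycPowUnit p 1)
  refine ⟨γ, ?_, ?_⟩
  · rw [ZpExtension.IsTopGenerator, zpExtension_apply, hγ, ell_cycPowUnit]
  · rw [hγ, val_cycPowUnit, cycPow_one]

end Literature.NumberTheory.EllipticCurves.CyclotomicZp

namespace Literature.NumberTheory.EllipticCurves.ZpExtension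

/-- Discharge of the `K = ℚ` instance of the named fact `Literature.NumberTheory.EllipticCurves.ZpExtension.exists_isCyclotomic`
(existence of the cyclotomic `ℤ_p`-extension; the infinitude hypothesis is not even needed over
`ℚ`). [cite: Washington1997, §13.1] -/
theorem exists_isCyclotomic_rat (p : ℕ) [Fact p.Prime] : exists_isCyclotomic ℚ p :=
  fun _ ↦ ⟨CyclotomicZp.zpExtension p, CyclotomicZp.isCyclotomic_zpExtension p⟩

end Literature.NumberTheory.EllipticCurves.ZpExtension

namespace Literature.NumberTheory.EllipticCurves

/-- Discharge of the `K = ℚ` instance of the named fact `Literature.NumberTheory.EllipticCurves.exists_cyclotomicZpExtension`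
(bsd.S22, existence of the cyclotomic `ℤ_p`-extension of a number field; Washington §13.1,
p. 264), by the construction `Literature.NumberTheory.EllipticCurves.CyclotomicZp.zpExtension`. [cite: Washington1997, §13.1 (p. 264)] -/
theorem exists_cyclotomicZpExtension_rat (p : ℕ) [Fact p.Prime] :
    exists_cyclotomicZpExtension ℚ p :=
  ⟨CyclotomicZp.zpExtension p, CyclotomicZp.isCyclotomic_zpExtension p⟩

end Literature.NumberTheory.EllipticCurves
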